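import Summits.QuantumFields.BalabanUV.Beta.FP.NestedStepLawMovingBorder

/-!
# Slice exchange with gauge invariance on `ker Q` only, and the nesting of Faddeev–Popov operators (road «FP», route T row (SX-STEP))

Owner file of road «FP» (unit `b2b-balaban-beta-d1-p3`, gen 16), proposed ruling R-FP-52 (journal l.36221) on the located row (SX-STEP) of R-FP-51, after
the letter supplier an3's memos `FP-SYM.v1.md` §2 (LEMMA SX) and `SXSTEP-AN3.v1.md` §1 (LEMMA N).  LEMMA SX in determinant form is already the tree's
`GaugeFixing.det_kkt_fromRows_slice_change` (`det kkt K [Q;P]·det(τW)² = det kkt K [Q;τ]·det(PW)²` under the TWO-SIDED degeneracy `K W = 0`, `Kᵀ W = 0`,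
`Q W = 0`).  This file adds the two S-sized pieces route T needs and nothing else:

* §1 **Form shears are invisible to the sliced bordered determinant**: `det kkt (K + QᵀN) [Q;L] = det kkt K [Q;L] = det kkt (K + NᵀQ) [Q;L]` (column ∕ row
  shear by the constraint block), hence **LEMMA SX WITH GAUGE INVARIANCE ON `ker Q` ONLY** (`det_kkt_fromRows_slice_change_of_range`): the hypotheses
  `K W = Qᵀ Y`, `Kᵀ W = Qᵀ Y'` (an3's (F2): at a non-zero background the one-loop form is gauge invariant only on the constrained space) replace `K W = 0`,
  `Kᵀ W = 0` — reduce to the tree lemma by shearing `K` to `K − Qᵀ(Y(τW)⁻¹τ) − (Y'(τW)⁻¹τ)ᵀQ`, which IS two-sidedly degenerate.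
* §2 **LEMMA N (algebraic core)**: gauge parameters split `γ₁ ⊕ γ₂` (fine-residual ⊕ block-constant), generators `[D₁ | D₂]`, one-step averaging `Q₁` with
  `Q₁D₁ = 0` and `Q₁D₂ = D̄` (covariance of the averaging); then the nested slice `[τ₁; τ₂Q₁]` has block-TRIANGULAR Faddeev–Popov operator and
  `det([τ₁; τ₂Q₁]·[D₁|D₂]) = det(τ₁D₁)·det(τ₂D̄)` (both row orders) — «transport of FP factors is exact at one loop».
* §3 **Second variations**: along `C²` background curves (everything moving: form, constraint, both slices, generators), if the two FP determinants have
  CONSTANT modulus near `0` (tree∕comb slices: an3's THEOREM R (4) + §2), the second variations of the two sliced bordered systems AGREE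
  (`secondVar_kkt_slice_change_of_const`) — the (SX-STEP) row of R-FP-52 at model level, with the torus-side unimodularity as its only input.

HONEST: model-level algebra; which slices are tree∕comb and `|det τD| = 1` on the torus are NOT proved here; nothing here is the road's (SDF), (D1),
BetaPertH, a continuum statement or Clay.
-/

noncomputable section

namespace Summit.QuantumFields.BalabanUV.Beta.FP.NestedSliceExchange

open Matrix Filter Finset
open scoped Topology
open Literature.MathematicalPhysics.QuantumFieldTheory.Balaban1983to89.Beta.Composition (kkt)
open Literature.MathematicalPhysics.QuantumFieldTheory.Balaban1983to89.Beta.GaugeFixing (det_kkt_kkt det_kkt_fromRows_slice_change)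
open Summit.QuantumFields.BalabanUV.Beta.D1BFx.LogDetSecondVariation (secondVar secondVar_eq_of_logAbsDet_eq)
open Summit.QuantumFields.BalabanUV.Beta.D1BFx.SliceTransferModel (hasDerivAt_matMul hasDerivAt_kkt_fromRows)
open Literature.Analysis.Calculus (eventually_det_ne_zero)

/-! ## §1 Form shears by the constraint block; LEMMA SX with gauge invariance on `ker Q` only -/

section Shear

variable {𝕜 : Type*} [Field 𝕜]
variable {ν μ ρ : Type*} [Fintype ν] [Fintype μ] [Fintype ρ] [DecidableEq ν] [DecidableEq μ] [DecidableEq ρ]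

/-- [folklore] column shear: `kkt (K + QᵀN) Q = kkt K Q · [[1,0],[N,1]]`. -/
theorem kkt_add_transpose_mul (K : Matrix ν ν 𝕜) (Q N : Matrix μ ν 𝕜) :
    kkt (K + Qᵀ * N) Q = kkt K Q * fromBlocks 1 0 N (1 : Matrix μ μ 𝕜) := by
  unfold kkt
  rw [fromBlocks_multiply]
  simp

/-- [folklore] row shear: `kkt (K + NᵀQ) Q = [[1,Nᵀ],[0,1]] · kkt K Q`. -/
theorem kkt_add_mul_transpose (K : Matrix ν ν 𝕜) (Q N : Matrix μ ν 𝕜) :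
    kkt (K + Nᵀ * Q) Q = fromBlocks 1 Nᵀ 0 (1 : Matrix μ μ 𝕜) * kkt K Q := by
  unfold kkt
  rw [fromBlocks_multiply]
  simp

/-- [folklore] bordering a right-sheared matrix by the padded slice `[L|0]`: the shear passes through (`[L|0]·[[1,0],[N,1]] = [L|0]`). -/
theorem kkt_mul_shear_fromCols (M : Matrix (ν ⊕ μ) (ν ⊕ μ) 𝕜) (N : Matrix μ ν 𝕜) (L : Matrix ρ ν 𝕜) :
    kkt (M * fromBlocks 1 0 N (1 : Matrix μ μ 𝕜)) (fromCols L (0 : Matrix ρ μ 𝕜))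
      = kkt M (fromCols L (0 : Matrix ρ μ 𝕜)) * fromBlocks (fromBlocks 1 0 N (1 : Matrix μ μ 𝕜)) 0 0 (1 : Matrix ρ ρ 𝕜) := by
  unfold kkt
  rw [fromBlocks_multiply, fromCols_mul_fromBlocks]
  simp

/-- [folklore] bordering a left-sheared matrix by `[L|0]`: `[[1,Nᵀ],[0,1]]·[L|0]ᵀ = [L|0]ᵀ`. -/
theorem kkt_shear_mul_fromCols (M : Matrix (ν ⊕ μ) (ν ⊕ μ) 𝕜) (N : Matrix μ ν 𝕜) (L : Matrix ρ ν 𝕜) :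
    kkt (fromBlocks 1 Nᵀ 0 (1 : Matrix μ μ 𝕜) * M) (fromCols L (0 : Matrix ρ μ 𝕜))
      = fromBlocks (fromBlocks 1 Nᵀ 0 (1 : Matrix μ μ 𝕜)) 0 0 (1 : Matrix ρ ρ 𝕜) * kkt M (fromCols L (0 : Matrix ρ μ 𝕜)) := by
  unfold kkt
  rw [fromBlocks_multiply, transpose_fromCols, fromBlocks_mul_fromRows]
  simp

/-- [folklore] **FORM SHEARS ARE INVISIBLE TO THE SLICED BORDERED DETERMINANT (column form)**: `det kkt (K + QᵀN) [Q;L] = det kkt K [Q;L]`. -/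
theorem det_kkt_add_transpose_mul (K : Matrix ν ν 𝕜) (Q N : Matrix μ ν 𝕜) (L : Matrix ρ ν 𝕜) :
    (kkt (K + Qᵀ * N) (fromRows Q L)).det = (kkt K (fromRows Q L)).det := by
  rw [← det_kkt_kkt, ← det_kkt_kkt, kkt_add_transpose_mul, kkt_mul_shear_fromCols, det_mul, det_fromBlocks_zero₂₁, det_fromBlocks_zero₁₂]
  simp

/-- [folklore] **FORM SHEARS ARE INVISIBLE TO THE SLICED BORDERED DETERMINANT (row form)**: `det kkt (K + NᵀQ) [Q;L] = det kkt K [Q;L]`. -/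
theorem det_kkt_add_mul_transpose (K : Matrix ν ν 𝕜) (Q N : Matrix μ ν 𝕜) (L : Matrix ρ ν 𝕜) :
    (kkt (K + Nᵀ * Q) (fromRows Q L)).det = (kkt K (fromRows Q L)).det := by
  rw [← det_kkt_kkt, ← det_kkt_kkt, kkt_add_mul_transpose, kkt_shear_mul_fromCols, det_mul, det_fromBlocks_zero₂₁, det_fromBlocks_zero₂₁]
  simp

/-- [folklore] **LEMMA SX WITH GAUGE INVARIANCE ON `ker Q` ONLY.**  Form `K`, averaging constraint `Q`, gauge generators `W` with `Q·W = 0` (covariant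
averages) and `K·W = Qᵀ·Y`, `Kᵀ·W = Qᵀ·Y'` (the form is gauge invariant on the constrained space `ker Q` — NOT necessarily `K·W = 0`); two slices
`τ, P` with Faddeev–Popov operators `τ·W`, `P·W` invertible.  Then `det kkt K [Q;P] · det(τ·W)² = det kkt K [Q;τ] · det(P·W)²`. -/
theorem det_kkt_fromRows_slice_change_of_range (K : Matrix ν ν 𝕜) (Q : Matrix μ ν 𝕜) (τ P : Matrix ρ ν 𝕜) (W : Matrix ν ρ 𝕜) (Y Y' : Matrix μ ρ 𝕜)
    (hKW : K * W = Qᵀ * Y) (hKtW : Kᵀ * W = Qᵀ * Y') (hQW : Q * W = 0) (hT : IsUnit (τ * W).det) (hS : IsUnit (P * W).det) :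
    (kkt K (fromRows Q P)).det * (τ * W).det ^ 2 = (kkt K (fromRows Q τ)).det * (P * W).det ^ 2 := by
  -- shear the form to a two-sidedly degenerate one
  set A : Matrix μ ν 𝕜 := -(Y * (τ * W)⁻¹ * τ) with hA
  set B : Matrix μ ν 𝕜 := -(Y' * (τ * W)⁻¹ * τ) with hB
  set K' : Matrix ν ν 𝕜 := K + Qᵀ * A + Bᵀ * Q with hK'
  have hAW : A * W = -Y := by
    rw [hA, Matrix.neg_mul, Matrix.mul_assoc, Matrix.mul_assoc, Matrix.nonsing_inv_mul _ hT, Matrix.mul_one]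
  have hBW : B * W = -Y' := by
    rw [hB, Matrix.neg_mul, Matrix.mul_assoc, Matrix.mul_assoc, Matrix.nonsing_inv_mul _ hT, Matrix.mul_one]
  have hK'W : K' * W = 0 := by
    rw [hK', Matrix.add_mul, Matrix.add_mul, hKW, Matrix.mul_assoc, hAW, Matrix.mul_assoc, hQW, Matrix.mul_neg, Matrix.mul_zero, add_zero, add_neg_cancel]
  have hK'tW : K'ᵀ * W = 0 := by
    rw [hK', transpose_add, transpose_add, transpose_mul, transpose_mul, transpose_transpose, transpose_transpose, Matrix.add_mul, Matrix.add_mul,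
      hKtW, Matrix.mul_assoc, hQW, Matrix.mul_zero, add_zero, Matrix.mul_assoc, hBW, Matrix.mul_neg, add_neg_cancel]
  have hdet : ∀ X : Matrix ρ ν 𝕜, (kkt K' (fromRows Q X)).det = (kkt K (fromRows Q X)).det := fun X => by
    rw [hK', det_kkt_add_mul_transpose, det_kkt_add_transpose_mul]
  rw [← hdet P, ← hdet τ]
  exact det_kkt_fromRows_slice_change K' Q τ P W hK'W hK'tW hQW hT hS

end Shear

/-! ## §2 LEMMA N: the nested slice has block-triangular Faddeev–Popov operator -/

section Nesting

variable {𝕜 : Type*} [Field 𝕜]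
variable {ν μ γ₁ γ₂ : Type*} [Fintype ν] [Fintype μ] [Fintype γ₁] [Fintype γ₂] [DecidableEq γ₁] [DecidableEq γ₂]

/-- [folklore] **LEMMA N (one nesting step), fine slice first.**  `Q₁·D₁ = 0` (fine-residual gauge parameters do not move the averages), `Q₁·D₂ = D̄`
(block-constant ones induce the coarse gauge action) ⇒ `[τ₁; τ₂Q₁]·[D₁|D₂] = [[τ₁D₁, τ₁D₂],[0, τ₂D̄]]` and `det = det(τ₁D₁)·det(τ₂D̄)`. -/
theorem det_nestedSlice_mul_gauge (τ₁ : Matrix γ₁ ν 𝕜) (τ₂ : Matrix γ₂ μ 𝕜) (Q₁ : Matrix μ ν 𝕜) (D₁ : Matrix ν γ₁ 𝕜) (D₂ : Matrix ν γ₂ 𝕜)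
    (Dbar : Matrix μ γ₂ 𝕜) (h₁ : Q₁ * D₁ = 0) (h₂ : Q₁ * D₂ = Dbar) :
    (fromRows τ₁ (τ₂ * Q₁) * fromCols D₁ D₂).det = (τ₁ * D₁).det * (τ₂ * Dbar).det := by
  rw [fromRows_mul_fromCols, Matrix.mul_assoc, Matrix.mul_assoc, h₁, h₂, Matrix.mul_zero, det_fromBlocks_zero₂₁]

/-- [folklore] **LEMMA N, coarse slice first** (the row order of route T's `[[Q₂Q₁; τ₂Q₁]; τ₁]`): `det([τ₂Q₁; τ₁]·[D₂|D₁]) = det(τ₂D̄)·det(τ₁D₁)`. -/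
theorem det_nestedSlice_mul_gauge' (τ₁ : Matrix γ₁ ν 𝕜) (τ₂ : Matrix γ₂ μ 𝕜) (Q₁ : Matrix μ ν 𝕜) (D₁ : Matrix ν γ₁ 𝕜) (D₂ : Matrix ν γ₂ 𝕜)
    (Dbar : Matrix μ γ₂ 𝕜) (h₁ : Q₁ * D₁ = 0) (h₂ : Q₁ * D₂ = Dbar) :
    (fromRows (τ₂ * Q₁) τ₁ * fromCols D₂ D₁).det = (τ₂ * Dbar).det * (τ₁ * D₁).det := by
  rw [fromRows_mul_fromCols, Matrix.mul_assoc, Matrix.mul_assoc, h₁, h₂, Matrix.mul_zero, det_fromBlocks_zero₁₂]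

end Nesting

/-! ## §3 Second variations: constant-modulus Faddeev–Popov factors make the slice exchange free -/

section SecondVar

variable {ν μ ρ : Type*} [Fintype ν] [Fintype μ] [Fintype ρ] [DecidableEq ν] [DecidableEq μ] [DecidableEq ρ]

/-- [folklore] **(SX-STEP) AT MODEL LEVEL: CONSTANT-MODULUS FP FACTORS ⇒ EQUAL SECOND VARIATIONS.**  Along `C²` background curves of the form `K`, the
averaging `Q` and TWO slices `τ`, `P` (all moving), with moving gauge generators `W` satisfying near `0`: `Q·W = 0`, `K·W = QᵀY`, `Kᵀ·W = QᵀY'` (gauge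
invariance on `ker Q`), and with both Faddeev–Popov determinants of CONSTANT non-zero modulus near `0` (`|det τW| ≡ c`, `|det PW| ≡ c'` — tree∕comb
slices), the sliced bordered systems `kkt K [Q;P]` and `kkt K [Q;τ]` have the SAME second variation of `log|det|` at `0` (jets by the product rule,
displayed).  Proof: §1 pointwise ⇒ the two `log|det|` differ by the constant `2 log c' − 2 log c` near `0`; `LogDetSecondVariation.secondVar_eq_of_logAbsDet_eq`. -/
theorem secondVar_kkt_slice_change_of_const
    {K K₁ : ℝ → ν → ν → ℝ} {K₂ : Matrix ν ν ℝ} {Q Q₁ : ℝ → μ → ν → ℝ} {Q₂ : Matrix μ ν ℝ}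
    {τ τ₁ : ℝ → ρ → ν → ℝ} {τ₂ : Matrix ρ ν ℝ} {P P₁ : ℝ → ρ → ν → ℝ} {P₂ : Matrix ρ ν ℝ}
    {W : ℝ → ν → ρ → ℝ} {Y Y' : ℝ → μ → ρ → ℝ} {c c' : ℝ}
    (hK : ∀ᶠ u in 𝓝 (0 : ℝ), HasDerivAt K (K₁ u) u) (hK₁ : HasDerivAt K₁ (Matrix.of.symm K₂) 0)
    (hQ : ∀ᶠ u in 𝓝 (0 : ℝ), HasDerivAt Q (Q₁ u) u) (hQ₁ : HasDerivAt Q₁ (Matrix.of.symm Q₂) 0)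
    (hτ : ∀ᶠ u in 𝓝 (0 : ℝ), HasDerivAt τ (τ₁ u) u) (hτ₁ : HasDerivAt τ₁ (Matrix.of.symm τ₂) 0)
    (hP : ∀ᶠ u in 𝓝 (0 : ℝ), HasDerivAt P (P₁ u) u) (hP₁ : HasDerivAt P₁ (Matrix.of.symm P₂) 0)
    (hKW : ∀ᶠ u in 𝓝 (0 : ℝ), Matrix.of (K u) * Matrix.of (W u) = (Matrix.of (Q u))ᵀ * Matrix.of (Y u))
    (hKtW : ∀ᶠ u in 𝓝 (0 : ℝ), (Matrix.of (K u))ᵀ * Matrix.of (W u) = (Matrix.of (Q u))ᵀ * Matrix.of (Y' u))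
    (hQW : ∀ᶠ u in 𝓝 (0 : ℝ), Matrix.of (Q u) * Matrix.of (W u) = 0)
    (hτW : ∀ᶠ u in 𝓝 (0 : ℝ), |(Matrix.of (τ u) * Matrix.of (W u)).det| = c) (hPW : ∀ᶠ u in 𝓝 (0 : ℝ), |(Matrix.of (P u) * Matrix.of (W u)).det| = c')
    (hc : c ≠ 0) (hc' : c' ≠ 0)
    (h0 : (kkt (Matrix.of (K 0)) (fromRows (Matrix.of (Q 0)) (Matrix.of (τ 0)))).det ≠ 0) :
    secondVar (kkt (Matrix.of (K 0)) (fromRows (Matrix.of (Q 0)) (Matrix.of (P 0))))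
        (kkt (Matrix.of (K₁ 0)) (fromRows (Matrix.of (Q₁ 0)) (Matrix.of (P₁ 0)))) (kkt K₂ (fromRows Q₂ P₂))
      = secondVar (kkt (Matrix.of (K 0)) (fromRows (Matrix.of (Q 0)) (Matrix.of (τ 0))))
        (kkt (Matrix.of (K₁ 0)) (fromRows (Matrix.of (Q₁ 0)) (Matrix.of (τ₁ 0)))) (kkt K₂ (fromRows Q₂ τ₂)) := by
  have hK' : ∀ᶠ u in 𝓝 (0 : ℝ), HasDerivAt K (Matrix.of.symm (Matrix.of (K₁ u))) u := hK
  have hQ' : ∀ᶠ u in 𝓝 (0 : ℝ), HasDerivAt Q (Matrix.of.symm (Matrix.of (Q₁ u))) u := hQ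
  have hτ' : ∀ᶠ u in 𝓝 (0 : ℝ), HasDerivAt τ (Matrix.of.symm (Matrix.of (τ₁ u))) u := hτ
  have hP' : ∀ᶠ u in 𝓝 (0 : ℝ), HasDerivAt P (Matrix.of.symm (Matrix.of (P₁ u))) u := hP
  -- the two sliced bordered curves and their jets
  have hAd : ∀ᶠ u in 𝓝 (0 : ℝ), HasDerivAt (fun u => Matrix.of.symm (kkt (Matrix.of (K u)) (fromRows (Matrix.of (Q u)) (Matrix.of (P u)))))
      ((fun u => Matrix.of.symm (kkt (Matrix.of (K₁ u)) (fromRows (Matrix.of (Q₁ u)) (Matrix.of (P₁ u))))) u) u := by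
    filter_upwards [hK', hQ', hP'] with u huK huQ huP
    exact hasDerivAt_kkt_fromRows huK huQ huP
  have hA₁d : HasDerivAt (fun u => Matrix.of.symm (kkt (Matrix.of (K₁ u)) (fromRows (Matrix.of (Q₁ u)) (Matrix.of (P₁ u)))))
      (Matrix.of.symm (kkt K₂ (fromRows Q₂ P₂))) 0 := hasDerivAt_kkt_fromRows hK₁ hQ₁ hP₁
  have hBd : ∀ᶠ u in 𝓝 (0 : ℝ), HasDerivAt (fun u => Matrix.of.symm (kkt (Matrix.of (K u)) (fromRows (Matrix.of (Q u)) (Matrix.of (τ u)))))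
      ((fun u => Matrix.of.symm (kkt (Matrix.of (K₁ u)) (fromRows (Matrix.of (Q₁ u)) (Matrix.of (τ₁ u))))) u) u := by
    filter_upwards [hK', hQ', hτ'] with u huK huQ huτ
    exact hasDerivAt_kkt_fromRows huK huQ huτ
  have hB₁d : HasDerivAt (fun u => Matrix.of.symm (kkt (Matrix.of (K₁ u)) (fromRows (Matrix.of (Q₁ u)) (Matrix.of (τ₁ u)))))
      (Matrix.of.symm (kkt K₂ (fromRows Q₂ τ₂))) 0 := hasDerivAt_kkt_fromRows hK₁ hQ₁ hτ₁
  -- the `τ`-sliced system stays non-degenerate near `0`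
  have hB0 : (Matrix.of ((fun u => Matrix.of.symm (kkt (Matrix.of (K u)) (fromRows (Matrix.of (Q u)) (Matrix.of (τ u))))) 0)).det ≠ 0 := by
    simpa only [Equiv.apply_symm_apply] using h0
  have hBne := eventually_det_ne_zero hBd.self_of_nhds.hasFDerivAt hB0
  -- §1 pointwise: the `P`-sliced system is non-degenerate and the two `log|det|` differ by a constant near `0`
  have hpt : ∀ᶠ u in 𝓝 (0 : ℝ),
      (Matrix.of ((fun u => Matrix.of.symm (kkt (Matrix.of (K u)) (fromRows (Matrix.of (Q u)) (Matrix.of (P u))))) u)).det ≠ 0 ∧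
      Real.log |(Matrix.of ((fun u => Matrix.of.symm (kkt (Matrix.of (K u)) (fromRows (Matrix.of (Q u)) (Matrix.of (P u))))) u)).det|
        = Real.log |(Matrix.of ((fun u => Matrix.of.symm (kkt (Matrix.of (K u)) (fromRows (Matrix.of (Q u)) (Matrix.of (τ u))))) u)).det|
          + (2 * Real.log c' - 2 * Real.log c) := by
    filter_upwards [hKW, hKtW, hQW, hτW, hPW, hBne] with u huK huKt huQ huτ huP huB
    simp only [Equiv.apply_symm_apply] at huB ⊢
    have hT : IsUnit (Matrix.of (τ u) * Matrix.of (W u)).det :=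
      isUnit_iff_ne_zero.2 (by intro h; rw [h, abs_zero] at huτ; exact hc huτ.symm)
    have hS : IsUnit (Matrix.of (P u) * Matrix.of (W u)).det :=
      isUnit_iff_ne_zero.2 (by intro h; rw [h, abs_zero] at huP; exact hc' huP.symm)
    have hid := det_kkt_fromRows_slice_change_of_range (Matrix.of (K u)) (Matrix.of (Q u)) (Matrix.of (τ u)) (Matrix.of (P u)) (Matrix.of (W u))
      (Matrix.of (Y u)) (Matrix.of (Y' u)) huK huKt huQ hT hS
    have habs := congrArg (fun x : ℝ => |x|) hid
    simp only [abs_mul, abs_pow, huτ, huP] at habs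
    -- `|det A|·c² = |det B|·c'²` with `det B ≠ 0`
    have hBpos : 0 < |(kkt (Matrix.of (K u)) (fromRows (Matrix.of (Q u)) (Matrix.of (τ u)))).det| := abs_pos.2 huB
    have hAne : (kkt (Matrix.of (K u)) (fromRows (Matrix.of (Q u)) (Matrix.of (P u)))).det ≠ 0 := by
      intro hz
      rw [hz, abs_zero, zero_mul] at habs
      exact (mul_pos hBpos (by positivity)).ne habs
    have hApos : 0 < |(kkt (Matrix.of (K u)) (fromRows (Matrix.of (Q u)) (Matrix.of (P u)))).det| := abs_pos.2 hAne
    refine ⟨hAne, ?_⟩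
    have hlog' := congrArg Real.log habs
    rw [Real.log_mul hApos.ne' (by positivity), Real.log_mul hBpos.ne' (by positivity), Real.log_pow, Real.log_pow] at hlog'
    push_cast at hlog'
    linarith
  have hA0 := (hpt.self_of_nhds).1
  have hlog := hpt.mono fun u hu => hu.2
  have h := secondVar_eq_of_logAbsDet_eq hAd hA₁d hA0 hBd hB₁d hB0 hlog
  simp only [Equiv.apply_symm_apply] at h
  exact h

end SecondVar

end Summit.QuantumFields.BalabanUV.Beta.FP.NestedSliceExchange

end
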